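/-
Copyright (c) 2026 the pub-hodgecm-mathlib formalisation cell (harness21).  Prover seat hodgecm-mathlib-LH7-p07 (g2), Track B «K2-LIT» ∕ hLiu418, organ F4 (G-gen),
B3-b FILE 2a «THE ONE-PLACE LIFT AND THE PLACE-TUPLE RECURSION, GENERIC IN THE BIG DATUM» (LEAD F0P6-plan (g14) BATCH #152 (1) ∕ #158; F4 lead K2Liu-p27 (g2)
★ p863262 «per-place hlift := fock_induction_of_blockFFT_of_pivot»).  THEOREMS ONLY.
-/
import Summits.HodgeConjecture.HodgeConjecture.Theorems.K2LiuArchSWPlaceCyclic         -- ★ B3-a ED. 3 (K2Liu-p27): `fock_induction_of_blockFFT_of_pivot`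
import Summits.HodgeConjecture.HodgeConjecture.Theorems.K2LiuArchSWPlaceTransport      -- ★ (K2Liu-p05): `good_ap_am_of_derivLetters` (the `𝔭^±` closure from two derivative letters)
import Summits.HodgeConjecture.HodgeConjecture.Theorems.K2LiuArchSWDataInductionCore   -- ★ B3-core: `forall_of_vacuum_of_placeStep'` (the place-finset recursion)
import HarnessLib

/-!
# Crux `HLiu418`, organ F4 (G-gen), B3-b FILE 2a: THE ONE-PLACE LIFT AND THE PLACE-TUPLE RECURSION FOR «GOOD IN EVERY ADMISSIBLE DOMAIN», GENERIC IN THE BIG DATUM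

Cell `hodgecm-mathlib`, crux item hLiu418 = `stmt-HodgeConjecture-24832` (helper lane `--kind proof --supports stmt-HodgeConjecture-24832 --as helper`,
count-neutral; closes no socket); squad K2 ∕ K2Liu + F0∕P3c∕LH7; LEAD F0P6-plan (g14); F4 lead ∕ desk K2Liu-p27 (g2); boxes K2E5-r02 (g6), K2Liu-audit1 (g2);
consumer K2E3-p23 (g8) ★ p863249 `K2LiuArchSWDataFinalPassage` (its letter (gen)).  THEOREMS ONLY (no `def`, no `instance`, no notation, no named-fact
hypothesis, no `sorry`).

WHAT.  FACE-G's letter `hGgen` (★ `K2LiuFaceGAssembler.faceG_of_organs`, binder :170–233) is an induction principle for a property `Good V x` of admissible data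
`x ∈ D_V = span {E(a ⊗ f) : a ∈ V, f}`.  ★ FILE 3 (K2E3-p23) reduces it to the letter (gen): «`Good V′ ⟨E(t β ⊗ f), _⟩` for every member `t β` of a generating
family and every admissible `V′ ∋` it».  THIS FILE proves (gen) for the family of TUPLE VECTORS `t a` (`a` = one Fock polynomial per real place; ★ FILE 1
`K2LiuArchSWDataTuplesDefs.tupleVec`) from `hGgen`'s closure letters and the per-place letters of road (E), GENERICALLY IN THE BIG DATUM: the big arch space is
an abstract module `M`, the data map an abstract `E : M → F → X` additive and homogeneous in the arch slot, admissibility an abstract `Adm`, the reading an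
abstract `g : X → Y` (= the twisted Siegel–Weil generator family), the derivative letter an abstract relation `Der ξ y y′` (= `HasArchDeriv` of the
`s₀`-sections along `X_ξ ∈ 𝔲`), and the tuple-vector map an abstract `t` additive and homogeneous in each place slot.  FILE 2b instantiates (letters of record).
* §1 «GOOD AT `m`» calculus.  `GoodAt m f :≡ ∀ V′, Adm V′ → ∀ hx : E m f ∈ D_{V′}, Good V′ ⟨E m f, hx⟩` (spelled out; no definition) is moved by equality of
  readings (**`goodAt_of_apply_eq`**, from (congr)), holds at `0` (**`goodAt_zero`**), is additive and homogeneous in `m` inside a common admissible space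
  (**`goodAt_add`**, **`goodAt_smul`**, from (add)(smul)(congr) and a (dom) witness), and passes along a derivative letter (**`goodAt_of_der`**, from (deriv)).
* §2 **`goodAt_placeLift`** — THE ONE-PLACE LIFT: for a linear slot map `ι₁ : ℂ[Fock_σ] →ₗ M` read by a linear section functional `SW` on the one-place Schwartz
  space (`SW (B⁻¹F) = g (E (ι₁ F) f)`) with the see-saw pivot `hpiv` and the block first fundamental theorems `hR hS` (★ B3-a ED. 3 letters verbatim), and two
  derivative letters `hDXp ∕ hDXm` producing the `𝔭^±` symbols (★ K2Liu-p05 `good_ap_am_of_derivLetters` shape, `Good`-free), `GoodAt (ι₁ 1) f ⇒ GoodAt (ι₁ F) f`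
  for every Fock polynomial `F` — ★ `fock_induction_of_blockFFT_of_pivot` at `Good := fun F => GoodAt (ι₁ F) f`.
* §3 **`goodAt_tuple_of_placeLetters`** — THE PLACE-TUPLE RECURSION: the same letters at every real place `σ` with the other slots frozen (slot maps
  `F ↦ t (update rest σ F)`) and `GoodAt (t 1) f` at the all-vacuum tuple give `GoodAt (t a) f` for EVERY tuple `a` — ★ B3-core `forall_of_vacuum_of_placeStep'`.
References: [Howe1989] §3 (the polynomial Fock model is generated from the vacuum by `𝔭⁺` modulo `K`-invariants); [KudlaRallis1994] §3; [Folland1989] Prop. (4.39);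
[KashiwaraVergne1978] §II.5 — citations for the docstrings; the file itself is bookkeeping over ★ B3-a ∕ ★ B3-core ∕ ★ K2Liu-p05.
HONEST LABEL.  Count-neutral helper; `HC_CM` is proved only modulo the 7 printed citations (2 remaining named inputs: hLiu418 = `stmt-HodgeConjecture-24832`,
h413 = `stmt-HodgeConjecture-24833`) until rung 0 closes.
-/

set_option autoImplicit false
set_option linter.dupNamespace false -- the mandated namespace repeats `HodgeConjecture.HodgeConjecture`

noncomputable section

open scoped Matrix MatrixGroups SchwartzMap Real
open MvPolynomial Complex
open Literature.NumberTheory.Automorphic Literature.Analysis.SegalBargmann Literature.NumberTheory.Weil1964 Literature.NumberTheory.Weil1964.UnitaryWeil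
open Literature.RepresentationTheory.KonnoKonno2007 Literature.RepresentationTheory.KonnoKonno2007.RealDualPair
open Literature.RepresentationTheory.KonnoKonno2007.RealDualPair.UForm
open Summit.HodgeConjecture.HodgeConjecture.Cruxes.HLiu418.K2LiuArchSWPlaceCyclic
open Summit.HodgeConjecture.HodgeConjecture.Cruxes.HLiu418.K2LiuArchSWPlaceTransport
open Summit.HodgeConjecture.HodgeConjecture.Cruxes.HLiu418.K2LiuArchSWDataInductionCore

namespace Summit.HodgeConjecture.HodgeConjecture.Cruxes.HLiu418.K2LiuArchSWDataInductionLift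

/-! ## §1 The «good at `m`» calculus (any semiring) -/

section GoodAt

variable {𝕜 : Type*} [Semiring 𝕜] {M : Type*} [AddCommMonoid M] [Module 𝕜 M] {T : Type*} {N : Type*} [AddCommMonoid N] [Module 𝕜 N] {Y : Type*}
  (E : M → T → N) (Adm : Submodule 𝕜 M → Prop) (g : N → Y)
  (Good : (V : Submodule 𝕜 M) → ↥(Submodule.span 𝕜 {x : N | ∃ a ∈ V, ∃ f : T, x = E a f}) → Prop)

/-- **(congr) moves «good at `m`, `f`» along equal readings**: if `g (E m f) = g (E m′ f′)`, `m` lies in some admissible space and `Good` holds at `E m f` in every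
admissible domain containing it, then `Good` holds at `E m′ f′` in every admissible domain containing it. [cite: Howe1989, §3] -/
theorem goodAt_of_apply_eq
    (hcongr : ∀ (V V' : Submodule 𝕜 M) (x : ↥(Submodule.span 𝕜 {x : N | ∃ a ∈ V, ∃ f : T, x = E a f}))
      (x' : ↥(Submodule.span 𝕜 {x : N | ∃ a ∈ V', ∃ f : T, x = E a f})), g (x : N) = g (x' : N) → Good V x → Good V' x')
    {m m' : M} {f f' : T} (h : g (E m f) = g (E m' f')) (hm : ∃ V : Submodule 𝕜 M, Adm V ∧ m ∈ V)
    (hG : (∀ V' : Submodule 𝕜 M, Adm V' → ∀ hx : E m f ∈ Submodule.span 𝕜 {x : N | ∃ a ∈ V', ∃ f : T, x = E a f}, Good V' ⟨E m f, hx⟩)) :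
    (∀ V' : Submodule 𝕜 M, Adm V' → ∀ hx : E m' f' ∈ Submodule.span 𝕜 {x : N | ∃ a ∈ V', ∃ f : T, x = E a f}, Good V' ⟨E m' f', hx⟩) := by
  intro V' _hV' hx'
  obtain ⟨V, hV, hmV⟩ := hm
  have hx : E m f ∈ Submodule.span 𝕜 {x : N | ∃ a ∈ V, ∃ f : T, x = E a f} := Submodule.subset_span ⟨m, hmV, f, rfl⟩
  exact hcongr V V' ⟨E m f, hx⟩ ⟨E m' f', hx'⟩ h (hG V hV hx)

/-- **«good at `0`»** from (zero) (`E 0 f = 0` by homogeneity). [folklore] -/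
theorem goodAt_zero (hEsmul : ∀ (c : 𝕜) (a : M) (f : T), E (c • a) f = c • E a f) (hzero : ∀ V, Adm V → Good V 0) (f : T) :
    (∀ V' : Submodule 𝕜 M, Adm V' → ∀ hx : E 0 f ∈ Submodule.span 𝕜 {x : N | ∃ a ∈ V', ∃ f : T, x = E a f}, Good V' ⟨E 0 f, hx⟩) := by
  intro V' hV' hx
  have hE0 : E 0 f = 0 := by
    have h := hEsmul 0 0 f
    rwa [zero_smul, zero_smul] at h
  have h0 : (⟨E 0 f, hx⟩ : ↥(Submodule.span 𝕜 {x : N | ∃ a ∈ V', ∃ f : T, x = E a f})) = 0 := Subtype.ext hE0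
  rw [h0]
  exact hzero V' hV'

/-- **«good at» is additive in the arch slot** inside a common admissible space (from (add) there and (congr) back). [cite: Howe1989, §3] -/
theorem goodAt_add (hEadd : ∀ (a b : M) (f : T), E (a + b) f = E a f + E b f)
    (hcongr : ∀ (V V' : Submodule 𝕜 M) (x : ↥(Submodule.span 𝕜 {x : N | ∃ a ∈ V, ∃ f : T, x = E a f}))
      (x' : ↥(Submodule.span 𝕜 {x : N | ∃ a ∈ V', ∃ f : T, x = E a f})), g (x : N) = g (x' : N) → Good V x → Good V' x')
    (hadd : ∀ V, Adm V → ∀ x y : ↥(Submodule.span 𝕜 {x : N | ∃ a ∈ V, ∃ f : T, x = E a f}), Good V x → Good V y → Good V (x + y))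
    {m₁ m₂ : M} (hm : ∃ V : Submodule 𝕜 M, Adm V ∧ m₁ ∈ V ∧ m₂ ∈ V) (f : T)
    (h₁ : (∀ V' : Submodule 𝕜 M, Adm V' → ∀ hx : E m₁ f ∈ Submodule.span 𝕜 {x : N | ∃ a ∈ V', ∃ f : T, x = E a f}, Good V' ⟨E m₁ f, hx⟩))
    (h₂ : (∀ V' : Submodule 𝕜 M, Adm V' → ∀ hx : E m₂ f ∈ Submodule.span 𝕜 {x : N | ∃ a ∈ V', ∃ f : T, x = E a f}, Good V' ⟨E m₂ f, hx⟩)) :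
    (∀ V' : Submodule 𝕜 M, Adm V' → ∀ hx : E (m₁ + m₂) f ∈ Submodule.span 𝕜 {x : N | ∃ a ∈ V', ∃ f : T, x = E a f}, Good V' ⟨E (m₁ + m₂) f, hx⟩) := by
  intro V' _hV' hx'
  obtain ⟨V, hV, hm₁, hm₂⟩ := hm
  have hx₁ : E m₁ f ∈ Submodule.span 𝕜 {x : N | ∃ a ∈ V, ∃ f : T, x = E a f} := Submodule.subset_span ⟨m₁, hm₁, f, rfl⟩
  have hx₂ : E m₂ f ∈ Submodule.span 𝕜 {x : N | ∃ a ∈ V, ∃ f : T, x = E a f} := Submodule.subset_span ⟨m₂, hm₂, f, rfl⟩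
  have hs := hadd V hV ⟨E m₁ f, hx₁⟩ ⟨E m₂ f, hx₂⟩ (h₁ V hV hx₁) (h₂ V hV hx₂)
  exact hcongr V V' (⟨E m₁ f, hx₁⟩ + ⟨E m₂ f, hx₂⟩) ⟨E (m₁ + m₂) f, hx'⟩ (by show g (E m₁ f + E m₂ f) = g (E (m₁ + m₂) f); rw [hEadd]) hs

/-- **«good at» is homogeneous in the arch slot** (from (smul) in an admissible space containing `m` and (congr) back). [cite: Howe1989, §3] -/
theorem goodAt_smul (hEsmul : ∀ (c : 𝕜) (a : M) (f : T), E (c • a) f = c • E a f)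
    (hcongr : ∀ (V V' : Submodule 𝕜 M) (x : ↥(Submodule.span 𝕜 {x : N | ∃ a ∈ V, ∃ f : T, x = E a f}))
      (x' : ↥(Submodule.span 𝕜 {x : N | ∃ a ∈ V', ∃ f : T, x = E a f})), g (x : N) = g (x' : N) → Good V x → Good V' x')
    (hsmul : ∀ V, Adm V → ∀ (c : 𝕜) (x : ↥(Submodule.span 𝕜 {x : N | ∃ a ∈ V, ∃ f : T, x = E a f})), Good V x → Good V (c • x))
    {m : M} (hm : ∃ V : Submodule 𝕜 M, Adm V ∧ m ∈ V) (c : 𝕜) (f : T)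
    (h : (∀ V' : Submodule 𝕜 M, Adm V' → ∀ hx : E m f ∈ Submodule.span 𝕜 {x : N | ∃ a ∈ V', ∃ f : T, x = E a f}, Good V' ⟨E m f, hx⟩)) :
    (∀ V' : Submodule 𝕜 M, Adm V' → ∀ hx : E (c • m) f ∈ Submodule.span 𝕜 {x : N | ∃ a ∈ V', ∃ f : T, x = E a f}, Good V' ⟨E (c • m) f, hx⟩) := by
  intro V' _hV' hx'
  obtain ⟨V, hV, hmV⟩ := hm
  have hx : E m f ∈ Submodule.span 𝕜 {x : N | ∃ a ∈ V, ∃ f : T, x = E a f} := Submodule.subset_span ⟨m, hmV, f, rfl⟩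
  have hs := hsmul V hV c ⟨E m f, hx⟩ (h V hV hx)
  exact hcongr V V' (c • ⟨E m f, hx⟩) ⟨E (c • m) f, hx'⟩ (by show g (c • E m f) = g (E (c • m) f); rw [hEsmul]) hs

/-- **«good at» passes along a derivative letter** (from (deriv): `Good V x`, `Der ξ (g x) (g x′)` ⇒ `Good V′ x′`). [cite: MoeglinWaldspurger1995, IV.1.9]
[cite: Howe1989, §3] -/
theorem goodAt_of_der {Ξ : Type*} (Der : Ξ → Y → Y → Prop)
    (hderiv : ∀ V, Adm V → ∀ x : ↥(Submodule.span 𝕜 {x : N | ∃ a ∈ V, ∃ f : T, x = E a f}), Good V x →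
      ∀ (ξ : Ξ) (V' : Submodule 𝕜 M), Adm V' → ∀ x' : ↥(Submodule.span 𝕜 {x : N | ∃ a ∈ V', ∃ f : T, x = E a f}), Der ξ (g (x : N)) (g (x' : N)) → Good V' x')
    {m m' : M} (hm : ∃ V : Submodule 𝕜 M, Adm V ∧ m ∈ V) {f : T} (ξ : Ξ) (hD : Der ξ (g (E m f)) (g (E m' f)))
    (hG : (∀ V' : Submodule 𝕜 M, Adm V' → ∀ hx : E m f ∈ Submodule.span 𝕜 {x : N | ∃ a ∈ V', ∃ f : T, x = E a f}, Good V' ⟨E m f, hx⟩)) :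
    (∀ V' : Submodule 𝕜 M, Adm V' → ∀ hx : E m' f ∈ Submodule.span 𝕜 {x : N | ∃ a ∈ V', ∃ f : T, x = E a f}, Good V' ⟨E m' f, hx⟩) := by
  intro V' hV' hx'
  obtain ⟨V, hV, hmV⟩ := hm
  have hx : E m f ∈ Submodule.span 𝕜 {x : N | ∃ a ∈ V, ∃ f : T, x = E a f} := Submodule.subset_span ⟨m, hmV, f, rfl⟩
  exact hderiv V hV ⟨E m f, hx⟩ (hG V hV hx) ξ V' hV' ⟨E m' f, hx'⟩ hD

end GoodAt

/-! ## §2 The one-place lift (the Fock instance at one real place, big datum abstract) -/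

section PlaceLift

variable {M : Type*} [AddCommGroup M] [Module ℂ M] {T : Type*} {N : Type*} [AddCommGroup N] [Module ℂ N] {Y : Type*} [AddCommGroup Y] [Module ℂ Y]
  (E : M → T → N) (Adm : Submodule ℂ M → Prop) (g : N → Y)
  (Good : (V : Submodule ℂ M) → ↥(Submodule.span ℂ {x : N | ∃ a ∈ V, ∃ f : T, x = E a f}) → Prop)
  {Ξ : Type*} (Der : Ξ → Y → Y → Prop)
  (R S : Type*) [Fintype R] [DecidableEq R] [Fintype S] [DecidableEq S]

/-- **THE ONE-PLACE LIFT.**  At one real place (`U(𝔻_σ) = U(2,2)`, any compact partner `U(R) × U(S)`, vacuum exponents `e`): let `ι₁ : ℂ[Fock] →ₗ M` be a linear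
slot map into the big arch space, read through `f` by a linear section functional `SW` on the one-place Schwartz space (`SW (B⁻¹F) = g (E (ι₁ F) f)`) having
the see-saw pivot `hpiv` on `K_H` and the block first fundamental theorems `hR`, `hS` (★ B3-a ED. 3 letters verbatim); suppose every two slot vectors lie in a
common admissible space (`hdom`), the closure letters (congr)(zero)(add)(smul)(deriv) of `hGgen`, and the two DERIVATIVE LETTERS `hDXp ∕ hDXm`: the boost
`hypOpGen_{pq}` (resp. its `μ₀(D_{π∕2})`-conjugate) of `B⁻¹F` is `B⁻¹G` with `Der ξ (g (E (ι₁ F) f)) (g (E (ι₁ (c • F + G)) f))` for some direction `ξ` and scalar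
`c` (the `detChar′` term).  Then «good at `ι₁ 1`» implies «good at `ι₁ F`» for EVERY Fock polynomial `F` — ★ `fock_induction_of_blockFFT_of_pivot` at
`Good := fun F => GoodAt (ι₁ F) f`, its `𝔭^±` closure by ★ `good_ap_am_of_derivLetters`. [cite: Howe1989, §3] [cite: Folland1989, Prop. (4.39)]
[cite: KashiwaraVergne1978, §II.5] [cite: KudlaRallis1994, §3] -/
theorem goodAt_placeLift (e : VacExponents) (SW : SchwartzMap (DPIdx (Fin 2) (Fin 2) R S → ℝ) ℂ →ₗ[ℂ] Y)
    (hpiv : ∀ (k : Matrix.unitaryGroup R ℂ × Matrix.unitaryGroup S ℂ) (v : SchwartzMap (DPIdx (Fin 2) (Fin 2) R S → ℝ) ℂ),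
      SW (κOp R S e ((1, k) : DPK (Fin 2) (Fin 2) R S) v) = vacScalar e ((1, k) : DPK (Fin 2) (Fin 2) R S) • SW v)
    (hR : ∀ f : MvPolynomial ((Fin 2 × R) ⊕ (Fin 2 × R)) ℂ,
      (∀ c : Matrix.unitaryGroup R ℂ, aeval (Sum.elim (fun pr : Fin 2 × R => ∑ b : R, X (Sum.inl (pr.1, b)) * C ((c : Matrix R R ℂ) b pr.2))
          (fun qr : Fin 2 × R => ∑ b : R, X (Sum.inr (qr.1, b)) * C ((star (c : Matrix R R ℂ)) qr.2 b)) :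
            (Fin 2 × R) ⊕ (Fin 2 × R) → MvPolynomial ((Fin 2 × R) ⊕ (Fin 2 × R)) ℂ) f = f) →
        f ∈ Algebra.adjoin ℂ (Set.range fun ij : Fin 2 × Fin 2 =>
          (∑ r : R, X (Sum.inl (ij.1, r)) * X (Sum.inr (ij.2, r)) : MvPolynomial ((Fin 2 × R) ⊕ (Fin 2 × R)) ℂ)))
    (hS : ∀ g : MvPolynomial ((Fin 2 × S) ⊕ (Fin 2 × S)) ℂ,
      (∀ d : Matrix.unitaryGroup S ℂ, aeval (Sum.elim (fun pr : Fin 2 × S => ∑ b : S, X (Sum.inl (pr.1, b)) * C ((d : Matrix S S ℂ) b pr.2))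
          (fun qr : Fin 2 × S => ∑ b : S, X (Sum.inr (qr.1, b)) * C ((star (d : Matrix S S ℂ)) qr.2 b)) :
            (Fin 2 × S) ⊕ (Fin 2 × S) → MvPolynomial ((Fin 2 × S) ⊕ (Fin 2 × S)) ℂ) g = g) →
        g ∈ Algebra.adjoin ℂ (Set.range fun ij : Fin 2 × Fin 2 =>
          (∑ s : S, X (Sum.inl (ij.2, s)) * X (Sum.inr (ij.1, s)) : MvPolynomial ((Fin 2 × S) ⊕ (Fin 2 × S)) ℂ)))
    (hEadd : ∀ (a b : M) (f : T), E (a + b) f = E a f + E b f) (hEsmul : ∀ (c : ℂ) (a : M) (f : T), E (c • a) f = c • E a f)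
    (hcongr : ∀ (V V' : Submodule ℂ M) (x : ↥(Submodule.span ℂ {x : N | ∃ a ∈ V, ∃ f : T, x = E a f}))
      (x' : ↥(Submodule.span ℂ {x : N | ∃ a ∈ V', ∃ f : T, x = E a f})), g (x : N) = g (x' : N) → Good V x → Good V' x')
    (hzero : ∀ V, Adm V → Good V 0)
    (hadd : ∀ V, Adm V → ∀ x y : ↥(Submodule.span ℂ {x : N | ∃ a ∈ V, ∃ f : T, x = E a f}), Good V x → Good V y → Good V (x + y))
    (hsmul : ∀ V, Adm V → ∀ (c : ℂ) (x : ↥(Submodule.span ℂ {x : N | ∃ a ∈ V, ∃ f : T, x = E a f})), Good V x → Good V (c • x))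
    (hderiv : ∀ V, Adm V → ∀ x : ↥(Submodule.span ℂ {x : N | ∃ a ∈ V, ∃ f : T, x = E a f}), Good V x →
      ∀ (ξ : Ξ) (V' : Submodule ℂ M), Adm V' → ∀ x' : ↥(Submodule.span ℂ {x : N | ∃ a ∈ V', ∃ f : T, x = E a f}), Der ξ (g (x : N)) (g (x' : N)) → Good V' x')
    (ι₁ : MvPolynomial (DPIdx (Fin 2) (Fin 2) R S) ℂ →ₗ[ℂ] M) (hdom : ∀ F G : MvPolynomial (DPIdx (Fin 2) (Fin 2) R S) ℂ, ∃ V : Submodule ℂ M, Adm V ∧ ι₁ F ∈ V ∧ ι₁ G ∈ V)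
    (f : T) (hSW : ∀ F : MvPolynomial (DPIdx (Fin 2) (Fin 2) R S) ℂ, SW (binvPi F) = g (E (ι₁ F) f))
    (hDXp : ∀ (i : Fin 2 × Fin 2) (F : MvPolynomial (DPIdx (Fin 2) (Fin 2) R S) ℂ), ∃ (ξ : Ξ) (c : ℂ) (G : MvPolynomial (DPIdx (Fin 2) (Fin 2) R S) ℂ),
      binvPi G = hypOpGenC R S i.1 i.2 (binvPi F) ∧ Der ξ (g (E (ι₁ F) f)) (g (E (ι₁ (c • F + G)) f)))
    (hDXm : ∀ (i : Fin 2 × Fin 2) (F : MvPolynomial (DPIdx (Fin 2) (Fin 2) R S) ℂ), ∃ (ξ : Ξ) (c : ℂ) (G : MvPolynomial (DPIdx (Fin 2) (Fin 2) R S) ℂ),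
      binvPi G = unitaryOpPi (phaseU R S i.1 (π / 2)) (hypOpGenC R S i.1 i.2 (unitaryOpPi (phaseU R S i.1 (π / 2))⁻¹ (binvPi F))) ∧
        Der ξ (g (E (ι₁ F) f)) (g (E (ι₁ (c • F + G)) f)))
    (hvac : (∀ V' : Submodule ℂ M, Adm V' → ∀ hx : E (ι₁ 1) f ∈ Submodule.span ℂ {x : N | ∃ a ∈ V', ∃ f : T, x = E a f}, Good V' ⟨E (ι₁ 1) f, hx⟩))
    (F : MvPolynomial (DPIdx (Fin 2) (Fin 2) R S) ℂ) :
    (∀ V' : Submodule ℂ M, Adm V' → ∀ hx : E (ι₁ F) f ∈ Submodule.span ℂ {x : N | ∃ a ∈ V', ∃ f : T, x = E a f}, Good V' ⟨E (ι₁ F) f, hx⟩) := by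
  have hm : ∀ F : MvPolynomial (DPIdx (Fin 2) (Fin 2) R S) ℂ, ∃ V : Submodule ℂ M, Adm V ∧ ι₁ F ∈ V := fun F => by
    obtain ⟨V, hV, h, -⟩ := hdom F F
    exact ⟨V, hV, h⟩
  -- closure of `F ↦ GoodAt (ι₁ F) f` under `+` and `•` (§1)
  have hadd₁ : ∀ F G : MvPolynomial (DPIdx (Fin 2) (Fin 2) R S) ℂ,
      (∀ V' : Submodule ℂ M, Adm V' → ∀ hx : E (ι₁ F) f ∈ Submodule.span ℂ {x : N | ∃ a ∈ V', ∃ f : T, x = E a f}, Good V' ⟨E (ι₁ F) f, hx⟩) →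
      (∀ V' : Submodule ℂ M, Adm V' → ∀ hx : E (ι₁ G) f ∈ Submodule.span ℂ {x : N | ∃ a ∈ V', ∃ f : T, x = E a f}, Good V' ⟨E (ι₁ G) f, hx⟩) →
      (∀ V' : Submodule ℂ M, Adm V' → ∀ hx : E (ι₁ (F + G)) f ∈ Submodule.span ℂ {x : N | ∃ a ∈ V', ∃ f : T, x = E a f}, Good V' ⟨E (ι₁ (F + G)) f, hx⟩) := fun F G hF hG => by
    rw [map_add]
    exact goodAt_add E Adm g Good hEadd hcongr hadd (hdom F G) f hF hG
  have hsmul₁ : ∀ (c : ℂ) (F : MvPolynomial (DPIdx (Fin 2) (Fin 2) R S) ℂ),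
      (∀ V' : Submodule ℂ M, Adm V' → ∀ hx : E (ι₁ F) f ∈ Submodule.span ℂ {x : N | ∃ a ∈ V', ∃ f : T, x = E a f}, Good V' ⟨E (ι₁ F) f, hx⟩) →
      (∀ V' : Submodule ℂ M, Adm V' → ∀ hx : E (ι₁ (c • F)) f ∈ Submodule.span ℂ {x : N | ∃ a ∈ V', ∃ f : T, x = E a f}, Good V' ⟨E (ι₁ (c • F)) f, hx⟩) := fun c F hF => by
    rw [map_smul]
    exact goodAt_smul E Adm g Good hEsmul hcongr hsmul (hm F) c f hF
  -- the two derivative letters in ★ K2Liu-p05's `h₁ ∕ h₂` shape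
  have hAp : ∀ (i : Fin 2 × Fin 2) (F : MvPolynomial (DPIdx (Fin 2) (Fin 2) R S) ℂ),
      (∀ V' : Submodule ℂ M, Adm V' → ∀ hx : E (ι₁ F) f ∈ Submodule.span ℂ {x : N | ∃ a ∈ V', ∃ f : T, x = E a f}, Good V' ⟨E (ι₁ F) f, hx⟩) →
      (∀ V' : Submodule ℂ M, Adm V' → ∀ hx : E (ι₁ ((((2 * (π : ℂ)⁻¹ * I : ℂ) • (∑ s : S, pderivLin (Sum.inr (Sum.inl (i.1, s)) : DPIdx (Fin 2) (Fin 2) R S) ∘ₗ pderivLin (Sum.inl (Sum.inr (i.2, s)))) -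
          (2 * π * I : ℂ) • LinearMap.mulLeft ℂ (∑ r : R, X (Sum.inl (Sum.inl (i.1, r))) * X (Sum.inr (Sum.inr (i.2, r))) : MvPolynomial (DPIdx (Fin 2) (Fin 2) R S) ℂ))) F)) f ∈ Submodule.span ℂ {x : N | ∃ a ∈ V', ∃ f : T, x = E a f}, Good V' ⟨E (ι₁ ((((2 * (π : ℂ)⁻¹ * I : ℂ) • (∑ s : S, pderivLin (Sum.inr (Sum.inl (i.1, s)) : DPIdx (Fin 2) (Fin 2) R S) ∘ₗ pderivLin (Sum.inl (Sum.inr (i.2, s)))) -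
          (2 * π * I : ℂ) • LinearMap.mulLeft ℂ (∑ r : R, X (Sum.inl (Sum.inl (i.1, r))) * X (Sum.inr (Sum.inr (i.2, r))) : MvPolynomial (DPIdx (Fin 2) (Fin 2) R S) ℂ))) F)) f, hx⟩) ∧
        (∀ V' : Submodule ℂ M, Adm V' → ∀ hx : E (ι₁ ((((2 * π * I : ℂ) • LinearMap.mulLeft ℂ (∑ s : S, X (Sum.inr (Sum.inl (i.1, s))) * X (Sum.inl (Sum.inr (i.2, s))) : MvPolynomial (DPIdx (Fin 2) (Fin 2) R S) ℂ) -
        (2 * (π : ℂ)⁻¹ * I : ℂ) • ∑ r : R, pderivLin (Sum.inl (Sum.inl (i.1, r)) : DPIdx (Fin 2) (Fin 2) R S) ∘ₗ pderivLin (Sum.inr (Sum.inr (i.2, r))))) F)) f ∈ Submodule.span ℂ {x : N | ∃ a ∈ V', ∃ f : T, x = E a f}, Good V' ⟨E (ι₁ ((((2 * π * I : ℂ) • LinearMap.mulLeft ℂ (∑ s : S, X (Sum.inr (Sum.inl (i.1, s))) * X (Sum.inl (Sum.inr (i.2, s))) : MvPolynomial (DPIdx (Fin 2) (Fin 2) R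 S) ℂ) -
        (2 * (π : ℂ)⁻¹ * I : ℂ) • ∑ r : R, pderivLin (Sum.inl (Sum.inl (i.1, r)) : DPIdx (Fin 2) (Fin 2) R S) ∘ₗ pderivLin (Sum.inr (Sum.inr (i.2, r))))) F)) f, hx⟩) := fun i F hF => by
    refine good_ap_am_of_derivLetters R S i.1 i.2 (Good₁ := fun F => (∀ V' : Submodule ℂ M, Adm V' → ∀ hx : E (ι₁ F) f ∈ Submodule.span ℂ {x : N | ∃ a ∈ V', ∃ f : T, x = E a f}, Good V' ⟨E (ι₁ F) f, hx⟩)) hadd₁ hsmul₁ F ?_ ?_ hF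
    · obtain ⟨ξ, c, G, hG, hD⟩ := hDXp i F
      exact ⟨c, G, hG, goodAt_of_der E Adm g Good Der hderiv (hm F) ξ hD hF⟩
    · obtain ⟨ξ, c, G, hG, hD⟩ := hDXm i F
      exact ⟨c, G, hG, goodAt_of_der E Adm g Good Der hderiv (hm F) ξ hD hF⟩
  refine fock_induction_of_blockFFT_of_pivot R S e SW hpiv hR hS (Good := fun F => (∀ V' : Submodule ℂ M, Adm V' → ∀ hx : E (ι₁ F) f ∈ Submodule.span ℂ {x : N | ∃ a ∈ V', ∃ f : T, x = E a f}, Good V' ⟨E (ι₁ F) f, hx⟩)) ?_ hadd₁ hsmul₁ hvac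
    (fun i F hF => (hAp i F hF).1) (fun i F hF => (hAp i F hF).2) (fun v v' hvv' hv => ?_) F
  · -- «good at `ι₁ 0 = 0`»
    show (∀ V' : Submodule ℂ M, Adm V' → ∀ hx : E (ι₁ 0) f ∈ Submodule.span ℂ {x : N | ∃ a ∈ V', ∃ f : T, x = E a f}, Good V' ⟨E (ι₁ 0) f, hx⟩)
    rw [map_zero]
    exact goodAt_zero E Adm Good hEsmul hzero f
  · -- same section ⇒ same reading ⇒ (congr)
    rw [hSW, hSW] at hvv'
    exact goodAt_of_apply_eq E Adm g Good hcongr hvv' (hm v) hv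

end PlaceLift

/-! ## §3 The place-tuple recursion -/

section Tuples

variable {M : Type*} [AddCommGroup M] [Module ℂ M] {T : Type*} {N : Type*} [AddCommGroup N] [Module ℂ N] {Y : Type*} [AddCommGroup Y] [Module ℂ Y]
  (E : M → T → N) (Adm : Submodule ℂ M → Prop) (g : N → Y)
  (Good : (V : Submodule ℂ M) → ↥(Submodule.span ℂ {x : N | ∃ a ∈ V, ∃ f : T, x = E a f}) → Prop)
  {Ξ : Type*} (Der : Ξ → Y → Y → Prop)
  {Ω : Type*} [Fintype Ω] [DecidableEq Ω] (R S : Ω → Type*) [∀ σ, Fintype (R σ)] [∀ σ, DecidableEq (R σ)] [∀ σ, Fintype (S σ)] [∀ σ, DecidableEq (S σ)]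

/-- **THE PLACE-TUPLE RECURSION — «GOOD AT EVERY TUPLE VECTOR».**  Tuples `a` = one Fock polynomial `a σ ∈ ℂ[DPIdx (Fin 2) (Fin 2) R_σ S_σ]` per real place `σ ∈ Ω`,
tuple-vector map `t` (additive and homogeneous in each slot), and AT EVERY PLACE `σ` WITH THE OTHER SLOTS FROZEN at `rest` the letters of §2: a linear section
functional `SW σ rest` with `SW σ rest (B⁻¹F) = g (E (t (update rest σ F)) f)`, its see-saw pivot, the block first fundamental theorems at `σ`, and the two
derivative letters.  Then `hGgen`'s closure letters, a common admissible space for every two tuple vectors, and «good at the all-vacuum tuple `t 1`» give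
«good at `t a`» for EVERY tuple `a` (★ B3-core `forall_of_vacuum_of_placeStep'`, step := §2 `goodAt_placeLift` at the slot map `F ↦ t (update rest σ F)`).
[cite: Howe1989, §3] [cite: KudlaRallis1994, §3] [cite: Folland1989, Prop. (4.39)] -/
theorem goodAt_tuple_of_placeLetters (e : Ω → VacExponents)
    (t : ((σ : Ω) → MvPolynomial (DPIdx (Fin 2) (Fin 2) (R σ) (S σ)) ℂ) → M)
    (ht_add : ∀ (σ : Ω) (rest : (τ : Ω) → MvPolynomial (DPIdx (Fin 2) (Fin 2) (R τ) (S τ)) ℂ) (F G : MvPolynomial (DPIdx (Fin 2) (Fin 2) (R σ) (S σ)) ℂ),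
      t (Function.update rest σ (F + G)) = t (Function.update rest σ F) + t (Function.update rest σ G))
    (ht_smul : ∀ (σ : Ω) (rest : (τ : Ω) → MvPolynomial (DPIdx (Fin 2) (Fin 2) (R τ) (S τ)) ℂ) (c : ℂ) (F : MvPolynomial (DPIdx (Fin 2) (Fin 2) (R σ) (S σ)) ℂ),
      t (Function.update rest σ (c • F)) = c • t (Function.update rest σ F))
    (SW : (σ : Ω) → ((τ : Ω) → MvPolynomial (DPIdx (Fin 2) (Fin 2) (R τ) (S τ)) ℂ) → (SchwartzMap (DPIdx (Fin 2) (Fin 2) (R σ) (S σ) → ℝ) ℂ →ₗ[ℂ] Y))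
    (hpiv : ∀ (σ : Ω) (rest : (τ : Ω) → MvPolynomial (DPIdx (Fin 2) (Fin 2) (R τ) (S τ)) ℂ)
      (k : Matrix.unitaryGroup (R σ) ℂ × Matrix.unitaryGroup (S σ) ℂ) (v : SchwartzMap (DPIdx (Fin 2) (Fin 2) (R σ) (S σ) → ℝ) ℂ),
      SW σ rest (κOp (R σ) (S σ) (e σ) ((1, k) : DPK (Fin 2) (Fin 2) (R σ) (S σ)) v) = vacScalar (e σ) ((1, k) : DPK (Fin 2) (Fin 2) (R σ) (S σ)) • SW σ rest v)
    (hR : ∀ (σ : Ω) (f : MvPolynomial ((Fin 2 × R σ) ⊕ (Fin 2 × R σ)) ℂ),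
      (∀ c : Matrix.unitaryGroup (R σ) ℂ, aeval (Sum.elim (fun pr : Fin 2 × R σ => ∑ b : R σ, X (Sum.inl (pr.1, b)) * C ((c : Matrix (R σ) (R σ) ℂ) b pr.2))
          (fun qr : Fin 2 × R σ => ∑ b : R σ, X (Sum.inr (qr.1, b)) * C ((star (c : Matrix (R σ) (R σ) ℂ)) qr.2 b)) :
            (Fin 2 × R σ) ⊕ (Fin 2 × R σ) → MvPolynomial ((Fin 2 × R σ) ⊕ (Fin 2 × R σ)) ℂ) f = f) →
        f ∈ Algebra.adjoin ℂ (Set.range fun ij : Fin 2 × Fin 2 =>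
          (∑ r : R σ, X (Sum.inl (ij.1, r)) * X (Sum.inr (ij.2, r)) : MvPolynomial ((Fin 2 × R σ) ⊕ (Fin 2 × R σ)) ℂ)))
    (hS : ∀ (σ : Ω) (g : MvPolynomial ((Fin 2 × S σ) ⊕ (Fin 2 × S σ)) ℂ),
      (∀ d : Matrix.unitaryGroup (S σ) ℂ, aeval (Sum.elim (fun pr : Fin 2 × S σ => ∑ b : S σ, X (Sum.inl (pr.1, b)) * C ((d : Matrix (S σ) (S σ) ℂ) b pr.2))
          (fun qr : Fin 2 × S σ => ∑ b : S σ, X (Sum.inr (qr.1, b)) * C ((star (d : Matrix (S σ) (S σ) ℂ)) qr.2 b)) :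
            (Fin 2 × S σ) ⊕ (Fin 2 × S σ) → MvPolynomial ((Fin 2 × S σ) ⊕ (Fin 2 × S σ)) ℂ) g = g) →
        g ∈ Algebra.adjoin ℂ (Set.range fun ij : Fin 2 × Fin 2 =>
          (∑ s : S σ, X (Sum.inl (ij.2, s)) * X (Sum.inr (ij.1, s)) : MvPolynomial ((Fin 2 × S σ) ⊕ (Fin 2 × S σ)) ℂ)))
    (hEadd : ∀ (a b : M) (f : T), E (a + b) f = E a f + E b f) (hEsmul : ∀ (c : ℂ) (a : M) (f : T), E (c • a) f = c • E a f)
    (hcongr : ∀ (V V' : Submodule ℂ M) (x : ↥(Submodule.span ℂ {x : N | ∃ a ∈ V, ∃ f : T, x = E a f}))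
      (x' : ↥(Submodule.span ℂ {x : N | ∃ a ∈ V', ∃ f : T, x = E a f})), g (x : N) = g (x' : N) → Good V x → Good V' x')
    (hzero : ∀ V, Adm V → Good V 0)
    (hadd : ∀ V, Adm V → ∀ x y : ↥(Submodule.span ℂ {x : N | ∃ a ∈ V, ∃ f : T, x = E a f}), Good V x → Good V y → Good V (x + y))
    (hsmul : ∀ V, Adm V → ∀ (c : ℂ) (x : ↥(Submodule.span ℂ {x : N | ∃ a ∈ V, ∃ f : T, x = E a f})), Good V x → Good V (c • x))
    (hderiv : ∀ V, Adm V → ∀ x : ↥(Submodule.span ℂ {x : N | ∃ a ∈ V, ∃ f : T, x = E a f}), Good V x →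
      ∀ (ξ : Ξ) (V' : Submodule ℂ M), Adm V' → ∀ x' : ↥(Submodule.span ℂ {x : N | ∃ a ∈ V', ∃ f : T, x = E a f}), Der ξ (g (x : N)) (g (x' : N)) → Good V' x')
    (hdom : ∀ a b : (σ : Ω) → MvPolynomial (DPIdx (Fin 2) (Fin 2) (R σ) (S σ)) ℂ, ∃ V : Submodule ℂ M, Adm V ∧ t a ∈ V ∧ t b ∈ V)
    (f : T)
    (hSW : ∀ (σ : Ω) (rest : (τ : Ω) → MvPolynomial (DPIdx (Fin 2) (Fin 2) (R τ) (S τ)) ℂ) (F : MvPolynomial (DPIdx (Fin 2) (Fin 2) (R σ) (S σ)) ℂ),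
      SW σ rest (binvPi F) = g (E (t (Function.update rest σ F)) f))
    (hDXp : ∀ (σ : Ω) (rest : (τ : Ω) → MvPolynomial (DPIdx (Fin 2) (Fin 2) (R τ) (S τ)) ℂ) (i : Fin 2 × Fin 2) (F : MvPolynomial (DPIdx (Fin 2) (Fin 2) (R σ) (S σ)) ℂ),
      ∃ (ξ : Ξ) (c : ℂ) (G : MvPolynomial (DPIdx (Fin 2) (Fin 2) (R σ) (S σ)) ℂ), binvPi G = hypOpGenC (R σ) (S σ) i.1 i.2 (binvPi F) ∧
        Der ξ (g (E (t (Function.update rest σ F)) f)) (g (E (t (Function.update rest σ (c • F + G))) f)))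
    (hDXm : ∀ (σ : Ω) (rest : (τ : Ω) → MvPolynomial (DPIdx (Fin 2) (Fin 2) (R τ) (S τ)) ℂ) (i : Fin 2 × Fin 2) (F : MvPolynomial (DPIdx (Fin 2) (Fin 2) (R σ) (S σ)) ℂ),
      ∃ (ξ : Ξ) (c : ℂ) (G : MvPolynomial (DPIdx (Fin 2) (Fin 2) (R σ) (S σ)) ℂ),
        binvPi G = unitaryOpPi (phaseU (R σ) (S σ) i.1 (π / 2)) (hypOpGenC (R σ) (S σ) i.1 i.2 (unitaryOpPi (phaseU (R σ) (S σ) i.1 (π / 2))⁻¹ (binvPi F))) ∧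
        Der ξ (g (E (t (Function.update rest σ F)) f)) (g (E (t (Function.update rest σ (c • F + G))) f)))
    (hvac : (∀ V' : Submodule ℂ M, Adm V' → ∀ hx : E (t fun _ => 1) f ∈ Submodule.span ℂ {x : N | ∃ a ∈ V', ∃ f : T, x = E a f}, Good V' ⟨E (t fun _ => 1) f, hx⟩))
    (a : (σ : Ω) → MvPolynomial (DPIdx (Fin 2) (Fin 2) (R σ) (S σ)) ℂ) :
    (∀ V' : Submodule ℂ M, Adm V' → ∀ hx : E (t a) f ∈ Submodule.span ℂ {x : N | ∃ a ∈ V', ∃ f : T, x = E a f}, Good V' ⟨E (t a) f, hx⟩) := by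
  refine forall_of_vacuum_of_placeStep' (fun σ => (1 : MvPolynomial (DPIdx (Fin 2) (Fin 2) (R σ) (S σ)) ℂ))
    (fun b => (∀ V' : Submodule ℂ M, Adm V' → ∀ hx : E (t b) f ∈ Submodule.span ℂ {x : N | ∃ a ∈ V', ∃ f : T, x = E a f}, Good V' ⟨E (t b) f, hx⟩)) hvac (fun σ rest v hv => ?_) a
  -- the one-place lift at `σ`, rest frozen: §2 at the slot map `F ↦ t (update rest σ F)`
  have key := goodAt_placeLift E Adm g Good Der (R σ) (S σ) (e σ) (SW σ rest) (hpiv σ rest) (hR σ) (hS σ) hEadd hEsmul hcongr hzero hadd hsmul hderiv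
    ({ toFun := fun F => t (Function.update rest σ F), map_add' := fun F G => ht_add σ rest F G,
       map_smul' := fun c F => by rw [RingHom.id_apply]; exact ht_smul σ rest c F } : MvPolynomial (DPIdx (Fin 2) (Fin 2) (R σ) (S σ)) ℂ →ₗ[ℂ] M)
    (fun F G => hdom _ _) f (fun F => hSW σ rest F) (fun i F => hDXp σ rest i F) (fun i F => hDXm σ rest i F) hv v
  exact key

end Tuples

end Summit.HodgeConjecture.HodgeConjecture.Cruxes.HLiu418.K2LiuArchSWDataInductionLift

end
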